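import Mathlib
import Summits.Schanuel.Schanuel.Theses.RigidCore
import Literature.NumberTheory.Transcendental.LocusComponents
import Literature.NumberTheory.Transcendental.GammaPointsDense

/-!
# Mate equivalence for first failures of Schanuel's conjecture (stub `stub_mateFirstFailure`)

Stub 3 of the line `kernel-arithmetic-selection` for the crux `RigidCore.MinimalCounterexampleInAcl`
(item stmt-Schanuel-0969). A *first failure* at rank `n` is a `ℚ`-linearly independent tuple
`x ∈ ℂⁿ` with `trdeg_ℚ ℚ(x, eˣ) < n` such that Schanuel's conjecture holds in every rank `r < n`
(`Literature.NumberTheory.Transcendental.SchanuelRank r`). A *mate* of `x` is a `ℚ`-linearly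
independent tuple `x'` such that the point `(x', e^{x'})` satisfies every `ℚ`-polynomial relation
of the point `(x, eˣ)`, i.e. `P_x ⊆ P_{x'}` for the prime ideals of relations in
`ℚ[X₁ … Xₙ, Y₁ … Yₙ]`.

**Claim.** A mate `x'` of a first failure `x` is again a first failure, and `P_{x'} = P_x` (so the
pulled-back `ℚ`-loci `{x'' | P_{x'} ⊆ P_{x''}}` and `{x'' | P_x ⊆ P_{x''}}` coincide).

**Proof.** Rank `0` carries no first failure (`trdeg < 0` is impossible), so `n = k + 1`.
Let `P = ker (ev_{(x, eˣ)}) ⊆ ℚ[X, Y]`, a prime ideal, and note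
`trdeg_ℚ (ℚ[X, Y] ⧸ ker ev_z) = trdeg_ℚ ℚ[z] = trdeg_ℚ ℚ(z)` for every point `z`
(first isomorphism theorem; a field generated by a set has the transcendence degree of the
algebra generated by it). Hence `trdeg_ℚ (ℚ[X, Y] ⧸ P) = trdeg_ℚ ℚ(x, eˣ) ≤ k`. On the other hand
`SchanuelRank k`, applied to the first `k` coordinates of the linearly independent tuple `x'`,
gives `k ≤ trdeg_ℚ ℚ(x', e^{x'}) = trdeg_ℚ ℚ[x', e^{x'}]`. The point `(x', e^{x'})` is a zero of
`P`, of transcendence degree `≥ trdeg_ℚ (ℚ[X, Y] ⧸ P)`, so it is a generic point of `Z(P)` over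
`ℚ`: `ker (ev_{(x', e^{x'})}) = P`
(`Literature.NumberTheory.Transcendental.LocusComponents.isGenericPt_of_trdeg_le`, the
dimension count of Bays–Kirby 2018, Lemma 8.3). Equality of the kernels gives both the equality of
the loci and `trdeg_ℚ ℚ(x', e^{x'}) = trdeg_ℚ ℚ(x, eˣ) < n`.

Sources: Mathlib (`Ideal.quotientKerEquivRange`, `AlgEquiv.trdeg_eq`,
`Cardinal.lt_natCast_add_one_iff`) and the tree
(`LocusComponents.isGenericPt_of_trdeg_le`, `trdeg_intermediateField_adjoin_eq`,
`trdeg_intermediateField_adjoin_mono`).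
-/

set_option linter.dupNamespace false

namespace Summit.Schanuel.Schanuel.Cruxes.MinimalCounterexampleInAcl.KernelArithmeticSelection

open Complex Set MvPolynomial Literature.NumberTheory.Transcendental

/-- The transcendence degree of a commutative `ℚ`-algebra does not depend on the `ℚ`-algebra
structure, of which there is at most one (`Rat.algebra_rat_subsingleton`). Used to pass between
the two (equal, but not reducibly) `ℚ`-algebra structures `DivisionRing.toRatAlgebra` and
`IntermediateField.algebra'` on an intermediate field of `ℂ / ℚ`. -/
private theorem trdeg_rat_irrel {K : Type} {instK : CommRing K} (i₁ i₂ : Algebra ℚ K) :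
    @Algebra.trdeg ℚ K _ instK i₁ = @Algebra.trdeg ℚ K _ instK i₂ := by
  rw [Subsingleton.elim i₁ i₂]

/-- `trdeg_ℚ ℚ(S) = trdeg_ℚ ℚ[S]` (tree lemma `trdeg_intermediateField_adjoin_eq`, restated over the
`ℚ`-algebra structure `DivisionRing.toRatAlgebra` found by instance search in this file). -/
private theorem trdeg_adjoin_eq_rat (S : Set ℂ) :
    Algebra.trdeg ℚ ↥(IntermediateField.adjoin ℚ S) = Algebra.trdeg ℚ ↥(Algebra.adjoin ℚ S) :=
  (trdeg_rat_irrel _ _).trans (trdeg_intermediateField_adjoin_eq S)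

/-- Monotonicity `S ⊆ ℚ(T) → trdeg_ℚ ℚ(S) ≤ trdeg_ℚ ℚ(T)` (tree lemma
`trdeg_intermediateField_adjoin_mono`, restated as in `trdeg_adjoin_eq_rat`). -/
private theorem trdeg_adjoin_mono_rat {S T : Set ℂ} (h : S ⊆ IntermediateField.adjoin ℚ T) :
    Algebra.trdeg ℚ ↥(IntermediateField.adjoin ℚ S) ≤
      Algebra.trdeg ℚ ↥(IntermediateField.adjoin ℚ T) :=
  (trdeg_rat_irrel _ _).trans_le
    ((trdeg_intermediateField_adjoin_mono h).trans_eq (trdeg_rat_irrel _ _))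

/-- `trdeg_ℚ (ℚ[X] ⧸ ker ev_z) = trdeg_ℚ ℚ(z)`: the quotient by the ideal of relations of a point
`z` is `ℚ[z]` (first isomorphism theorem), whose fraction field `ℚ(z)` has the same transcendence
degree. -/
private theorem trdeg_quotient_ker_aeval {ι : Type} (z : ι → ℂ) :
    Algebra.trdeg ℚ (MvPolynomial ι ℚ ⧸ RingHom.ker (aeval z : MvPolynomial ι ℚ →ₐ[ℚ] ℂ)) =
      Algebra.trdeg ℚ ↥(IntermediateField.adjoin ℚ (range z)) := by
  rw [trdeg_adjoin_eq_rat, Algebra.adjoin_range_eq_range_aeval]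
  exact (Ideal.quotientKerEquivRange (aeval z : MvPolynomial ι ℚ →ₐ[ℚ] ℂ)).trdeg_eq

/-- Schanuel's conjecture in rank `k`, applied to the first `k` coordinates of a `ℚ`-linearly
independent `(k+1)`-tuple `y`, gives `k ≤ trdeg_ℚ ℚ(y, eʸ)`. -/
private theorem le_trdeg_of_schanuelRank {k : ℕ} (hS : SchanuelRank k) {y : Fin (k + 1) → ℂ}
    (hy : LinearIndependent ℚ y) :
    (k : Cardinal) ≤
      Algebra.trdeg ℚ ↥(IntermediateField.adjoin ℚ (range y ∪ range (cexp ∘ y))) := by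
  refine (hS (y ∘ Fin.castSucc) (hy.comp _ (Fin.castSucc_injective k))).trans
    (trdeg_adjoin_mono_rat ?_)
  refine Set.Subset.trans ?_ (IntermediateField.subset_adjoin ℚ _)
  exact Set.union_subset_union (Set.range_comp_subset_range Fin.castSucc y)
    (Set.range_comp_subset_range Fin.castSucc (cexp ∘ y))

/-- **The core of mate equivalence**: if `trdeg_ℚ ℚ(x, eˣ) < n`, Schanuel holds in all ranks
`r < n`, and `x'` is `ℚ`-linearly independent with `P_x ⊆ P_{x'}`, then `P_{x'} = P_x`: a
`ℚ`-polynomial vanishes at `(x', e^{x'})` iff it vanishes at `(x, eˣ)`. -/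
private theorem aeval_eq_zero_iff_of_mate {n : ℕ} {x x' : Fin n → ℂ}
    (hxtr : Algebra.trdeg ℚ ↥(IntermediateField.adjoin ℚ (range x ∪ range (cexp ∘ x))) <
      (n : Cardinal))
    (hS : ∀ r < n, SchanuelRank r) (hx' : LinearIndependent ℚ x')
    (hmate : ∀ p : MvPolynomial (Fin n ⊕ Fin n) ℚ, aeval (Sum.elim x (cexp ∘ x)) p = 0 →
      aeval (Sum.elim x' (cexp ∘ x')) p = 0)
    (p : MvPolynomial (Fin n ⊕ Fin n) ℚ) :
    aeval (Sum.elim x' (cexp ∘ x')) p = 0 ↔ aeval (Sum.elim x (cexp ∘ x)) p = 0 := by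
  -- rank `0` carries no first failure: `n = k + 1`
  obtain ⟨k, rfl⟩ : ∃ k, n = k + 1 :=
    Nat.exists_eq_add_one_of_ne_zero (by rintro rfl; simp at hxtr)
  -- the prime ideal `P` of `ℚ`-polynomial relations of `(x, eˣ)`
  obtain ⟨P, hP⟩ : ∃ P : Ideal (MvPolynomial (Fin (k + 1) ⊕ Fin (k + 1)) ℚ),
      P = RingHom.ker (aeval (Sum.elim x (cexp ∘ x)) :
        MvPolynomial (Fin (k + 1) ⊕ Fin (k + 1)) ℚ →ₐ[ℚ] ℂ) := ⟨_, rfl⟩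
  haveI : P.IsPrime := by rw [hP]; exact RingHom.ker_isPrime _
  -- `(x', e^{x'})` is a zero of `P`
  have hz : Sum.elim x' (cexp ∘ x') ∈ zeroLocus ℂ P :=
    mem_zeroLocus_iff.2 fun q hq => hmate q (by rw [hP] at hq; exact RingHom.mem_ker.1 hq)
  -- dimension count: `trdeg ℚ[X, Y]⧸P = trdeg ℚ(x, eˣ) ≤ k ≤ trdeg ℚ(x', e^{x'}) = trdeg ℚ[x', e^{x'}]`
  have h1 : Algebra.trdeg ℚ (MvPolynomial (Fin (k + 1) ⊕ Fin (k + 1)) ℚ ⧸ P) ≤ (k : Cardinal) := by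
    rw [hP, trdeg_quotient_ker_aeval, Set.Sum.elim_range]
    exact Cardinal.lt_natCast_add_one_iff.1 (by exact_mod_cast hxtr)
  have h2 : (k : Cardinal) ≤
      Algebra.trdeg ℚ ↥(Algebra.adjoin ℚ (range (Sum.elim x' (cexp ∘ x')))) := by
    rw [← trdeg_adjoin_eq_rat, Set.Sum.elim_range]
    exact le_trdeg_of_schanuelRank (hS k (Nat.lt_succ_self k)) hx'
  -- genericity from transcendence degree: `I((x', e^{x'})/ℚ) = P`
  have hgen := LocusComponents.isGenericPt_of_trdeg_le P hz (h1.trans h2)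
  rw [hgen p, hP, RingHom.mem_ker]

/-- **Mate equivalence (stub `stub_mateFirstFailure` of the line `kernel-arithmetic-selection`).**
A mate `x'` of a first failure `x` at rank `n` (i.e. `x'` is `ℚ`-linearly independent and
`(x', e^{x'})` satisfies every `ℚ`-polynomial relation of `(x, eˣ)`) is again a first failure at
rank `n`, and the pulled-back `ℚ`-loci of `x'` and `x` coincide (`P_{x'} = P_x`). -/
theorem stub_mateFirstFailure : ∀ (n : ℕ) (x x' : Fin n → ℂ), (LinearIndependent ℚ x ∧ Algebra.trdeg ℚ ↥(IntermediateField.adjoin ℚ (Set.range x ∪ Set.range (Complex.exp ∘ x))) < (n : Cardinal) ∧ ∀ r < n, Literature.NumberTheory.Transcendental.SchanuelRank r) → (LinearIndependent ℚ x' ∧ ∀ p : MvPolynomial (Fin n ⊕ Fin n) ℚ, MvPolynomial.aeval (Sum.elim x (Complex.exp ∘ x)) p = 0 → MvPolynomial.aeval (Sum.elim x' (Complex.exp ∘ x')) p = 0) → (LinearIndependent ℚ x' ∧ Algebra.trdeg ℚ ↥(IntermediateField.adjoin ℚ (Set.range x' ∪ Set.range (Complex.exp ∘ x'))) < (n : Cardinal)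 ∧ ∀ r < n, Literature.NumberTheory.Transcendental.SchanuelRank r) ∧ {x'' : Fin n → ℂ | ∀ p : MvPolynomial (Fin n ⊕ Fin n) ℚ, MvPolynomial.aeval (Sum.elim x' (Complex.exp ∘ x')) p = 0 → MvPolynomial.aeval (Sum.elim x'' (Complex.exp ∘ x'')) p = 0} = {x'' : Fin n → ℂ | ∀ p : MvPolynomial (Fin n ⊕ Fin n) ℚ, MvPolynomial.aeval (Sum.elim x (Complex.exp ∘ x)) p = 0 → MvPolynomial.aeval (Sum.elim x'' (Complex.exp ∘ x'')) p = 0} := by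
  intro n x x' hx hx'
  -- the ideals of relations agree: `P_{x'} = P_x`
  have key := aeval_eq_zero_iff_of_mate hx.2.1 hx.2.2 hx'.1 hx'.2
  have hker : RingHom.ker (aeval (Sum.elim x' (cexp ∘ x')) :
      MvPolynomial (Fin n ⊕ Fin n) ℚ →ₐ[ℚ] ℂ) =
      RingHom.ker (aeval (Sum.elim x (cexp ∘ x)) : MvPolynomial (Fin n ⊕ Fin n) ℚ →ₐ[ℚ] ℂ) :=
    Ideal.ext fun p => by rw [RingHom.mem_ker, RingHom.mem_ker]; exact key p
  refine ⟨⟨hx'.1, ?_, hx.2.2⟩, Set.ext fun x'' => ?_⟩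
  · -- `trdeg ℚ(x', e^{x'}) = trdeg ℚ[X, Y]⧸P_{x'} = trdeg ℚ[X, Y]⧸P_x = trdeg ℚ(x, eˣ) < n`
    rw [← Set.Sum.elim_range, ← trdeg_quotient_ker_aeval, hker, trdeg_quotient_ker_aeval,
      Set.Sum.elim_range]
    exact hx.2.1
  · simp only [Set.mem_setOf_eq, key]

end Summit.Schanuel.Schanuel.Cruxes.MinimalCounterexampleInAcl.KernelArithmeticSelection
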